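import Summits.ResolutionOfSingularities.KangarooAtlas.MizutaniBoxDerivation
import Mathlib.RingTheory.Flat.Basic
import Mathlib.RingTheory.TensorProduct.Finite
import HarnessLib

/-!
# Base change of operators along `K ⊗_L K ≅ K[u]/(u_i^q)`: the transport `Φ ↦ Φ^♯`

Cell topic `Summits/ResolutionOfSingularities/KangarooAtlas` (pub-rosobs); namespace
`Summit.ResolutionOfSingularities.KangarooAtlas.Mizutani`.  Part of the Lean transcription of Mizutani 1973 §2
around the in-house note MIZUTANI-PROOF-g59 (AI-written, AI-audited; *AI review is weaker than expert review*; not a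
resolution theorem).  For a root tower `h : IsRootTower L K q x a` the map `Ω̃ : K ⊗_L K → K[u]/(u_i^q)`,
`y ⊗ z ↦ y · z(a + u)` is a `K`-linear bijection (`omegaTilde_bijective'`).  An `L`-linear operator `Φ` of `K` acts
on the right factor of `K ⊗_L K` (`K`-linearly for the left structure); transported to `K[u]/(u^q)` it becomes
the `K`-linear operator `Φ^♯` with `Φ^♯(y · tau z) = y · tau(Φ z)`:

* `IsRootTower.omegaEquiv` — `Ω̃` as a `K`-linear equivalence; `IsRootTower.sharp Φ = Ω̃ ∘ (1 ⊗ Φ) ∘ Ω̃⁻¹`;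
  `sharp_tmul`, `sharp_tau`, `sharp_comp`, `sharp_add`, `sharp_sub`, `sharp_smul` (`(c·Φ)^♯ = tau(c) · Φ^♯` — the
  coefficients become TAYLOR EXPANSIONS), `sharp_hsD_single` (`(D^{(e_i)})^♯ = ∂/∂u_i`);
* **`IsRootTower.finrank_ker_le_finrank_ker_sharp`** — `dim_L ker Φ ≤ dim_K ker Φ^♯` (`K ⊗_L ker Φ ↪ ker(1 ⊗ Φ)`
  by flatness): kernel bounds may be proved after base change, where the coefficients of a differential operator
  are units plus nilpotents.

References: [Mizutani1973HironakaGroupSchemes] Lemma 2.9 (proof); [Oda1983HironakaGroupSchemeII] §1 (p. 1166: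
`k ⊗_L k ≅ k[t]/(t^q)`); [EGAIV4] Thm. 16.11.2.
-/

open MvPolynomial TensorProduct Literature.AlgebraicGeometry.Resolution

namespace Summit.ResolutionOfSingularities.KangarooAtlas.Mizutani

universe u

section Sharp

variable {L K : Type u} [Field L] [Field K] [Algebra L K] {s p e : ℕ} [hp : Fact p.Prime] [CharP K p]
  {x : Fin s → L} {a : Fin s → K}

/-- **`Ω̃ : K ⊗_L K ≃ K[u]/(u^q)`** as a `K`-linear equivalence (left structure). [cite: Oda1983HironakaGroupSchemeII, §1 (p. 1166)] -/
noncomputable def IsRootTower.omegaEquiv (h : IsRootTower L K (p ^ e) x a) :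
    K ⊗[L] K ≃ₗ[K] BoxQuot (Fin s) K (p ^ e) :=
  LinearEquiv.ofBijective h.omegaLin h.omegaTilde_bijective'

/-- `omegaEquiv` is `Ω̃`. [folklore] -/
theorem IsRootTower.omegaEquiv_apply (h : IsRootTower L K (p ^ e) x a) (t : K ⊗[L] K) :
    h.omegaEquiv t = h.omegaTilde t := rfl

/-- `Ω̃ (y ⊗ z) = [C y] · tau z`. [folklore] -/
theorem IsRootTower.omegaEquiv_tmul (h : IsRootTower L K (p ^ e) x a) (y z : K) :
    h.omegaEquiv (y ⊗ₜ z) = Ideal.Quotient.mk _ (C y) * h.tau z := by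
  rw [h.omegaEquiv_apply, h.omegaTilde_tmul]

/-- **The transported operator `Φ^♯ = Ω̃ ∘ (1 ⊗ Φ) ∘ Ω̃⁻¹`** on `K[u]/(u^q)`, `K`-linear.
[cite: Mizutani1973HironakaGroupSchemes, Lemma 2.9 (proof); Oda1983HironakaGroupSchemeII, §1 (p. 1166)] -/
noncomputable def IsRootTower.sharp (h : IsRootTower L K (p ^ e) x a) (Φ : K →ₗ[L] K) :
    BoxQuot (Fin s) K (p ^ e) →ₗ[K] BoxQuot (Fin s) K (p ^ e) :=
  h.omegaEquiv.toLinearMap ∘ₗ Φ.baseChange K ∘ₗ h.omegaEquiv.symm.toLinearMap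

/-- `Φ^♯ (Ω̃ t) = Ω̃ ((1 ⊗ Φ) t)`. [folklore] -/
theorem IsRootTower.sharp_omegaEquiv (h : IsRootTower L K (p ^ e) x a) (Φ : K →ₗ[L] K) (t : K ⊗[L] K) :
    h.sharp Φ (h.omegaEquiv t) = h.omegaEquiv (Φ.baseChange K t) := by
  unfold IsRootTower.sharp
  rw [LinearMap.comp_apply, LinearMap.comp_apply, LinearEquiv.coe_toLinearMap, LinearEquiv.coe_toLinearMap,
    LinearEquiv.symm_apply_apply]

/-- **`Φ^♯ (y · tau z) = y · tau (Φ z)`.** [cite: Mizutani1973HironakaGroupSchemes, Lemma 2.9 (proof)] -/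
theorem IsRootTower.sharp_tmul (h : IsRootTower L K (p ^ e) x a) (Φ : K →ₗ[L] K) (y z : K) :
    h.sharp Φ (Ideal.Quotient.mk _ (C y) * h.tau z) = Ideal.Quotient.mk _ (C y) * h.tau (Φ z) := by
  rw [← h.omegaEquiv_tmul, h.sharp_omegaEquiv, LinearMap.baseChange_tmul, h.omegaEquiv_tmul]

/-- `Φ^♯ (tau z) = tau (Φ z)`. [folklore] -/
theorem IsRootTower.sharp_tau (h : IsRootTower L K (p ^ e) x a) (Φ : K →ₗ[L] K) (z : K) :
    h.sharp Φ (h.tau z) = h.tau (Φ z) := by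
  have := h.sharp_tmul Φ 1 z
  rwa [C_1, map_one, one_mul, one_mul] at this

/-- Two `K`-linear maps on `K[u]/(u^q)` agreeing on the `[C y] · tau z` agree. [folklore] -/
theorem IsRootTower.linearMap_ext_tau (h : IsRootTower L K (p ^ e) x a) {M : Type*} [AddCommGroup M] [Module K M]
    {f g : BoxQuot (Fin s) K (p ^ e) →ₗ[K] M}
    (hfg : ∀ y z : K, f (Ideal.Quotient.mk _ (C y) * h.tau z) = g (Ideal.Quotient.mk _ (C y) * h.tau z)) : f = g := by
  refine LinearMap.ext fun w => ?_
  obtain ⟨t, rfl⟩ := h.omegaEquiv.surjective w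
  induction t using TensorProduct.induction_on with
  | zero => rw [map_zero, map_zero, map_zero]
  | tmul y z => rw [h.omegaEquiv_tmul]; exact hfg y z
  | add t t' ht ht' => rw [map_add, map_add, map_add, ht, ht']

/-- `(Φ ∘ Ψ)^♯ = Φ^♯ ∘ Ψ^♯`. [folklore] -/
theorem IsRootTower.sharp_comp (h : IsRootTower L K (p ^ e) x a) (Φ Ψ : K →ₗ[L] K) :
    h.sharp (Φ ∘ₗ Ψ) = h.sharp Φ ∘ₗ h.sharp Ψ := by
  refine h.linearMap_ext_tau fun y z => ?_
  rw [h.sharp_tmul, LinearMap.comp_apply, LinearMap.comp_apply, h.sharp_tmul, h.sharp_tmul]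

/-- `(Φ + Ψ)^♯ = Φ^♯ + Ψ^♯`. [folklore] -/
theorem IsRootTower.sharp_add (h : IsRootTower L K (p ^ e) x a) (Φ Ψ : K →ₗ[L] K) :
    h.sharp (Φ + Ψ) = h.sharp Φ + h.sharp Ψ := by
  refine h.linearMap_ext_tau fun y z => ?_
  rw [h.sharp_tmul, LinearMap.add_apply, LinearMap.add_apply, h.sharp_tmul, h.sharp_tmul, map_add, mul_add]

/-- `(Φ − Ψ)^♯ = Φ^♯ − Ψ^♯`. [folklore] -/
theorem IsRootTower.sharp_sub (h : IsRootTower L K (p ^ e) x a) (Φ Ψ : K →ₗ[L] K) :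
    h.sharp (Φ - Ψ) = h.sharp Φ - h.sharp Ψ := by
  refine h.linearMap_ext_tau fun y z => ?_
  rw [h.sharp_tmul, LinearMap.sub_apply, LinearMap.sub_apply, h.sharp_tmul, h.sharp_tmul, map_sub, mul_sub]

/-- **`(c · Φ)^♯ = tau(c) · Φ^♯`**: post-multiplication by `c ∈ K` becomes multiplication by the TAYLOR EXPANSION
`tau c = c + Σ_{T ≠ 0} (D^{(T)} c) u^T` — a unit plus a nilpotent. [cite: Mizutani1973HironakaGroupSchemes, Lemma 2.9 (proof)] -/
theorem IsRootTower.sharp_smul (h : IsRootTower L K (p ^ e) x a) (c : K) (Φ : K →ₗ[L] K) (w : BoxQuot (Fin s) K (p ^ e)) :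
    h.sharp (c • Φ) w = h.tau c * h.sharp Φ w := by
  have key : h.sharp (c • Φ) = LinearMap.mulLeft K (h.tau c) ∘ₗ h.sharp Φ := by
    refine h.linearMap_ext_tau fun y z => ?_
    rw [h.sharp_tmul, LinearMap.comp_apply, h.sharp_tmul, LinearMap.mulLeft_apply, LinearMap.smul_apply, smul_eq_mul,
      map_mul]
    ring
  rw [key, LinearMap.comp_apply, LinearMap.mulLeft_apply]

/-- `(1)^♯ = 1`. [folklore] -/
theorem IsRootTower.sharp_id (h : IsRootTower L K (p ^ e) x a) : h.sharp LinearMap.id = LinearMap.id := by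
  refine h.linearMap_ext_tau fun y z => ?_
  rw [h.sharp_tmul, LinearMap.id_apply, LinearMap.id_apply]

/-- Post-multiplication by `c`, transported: `(c·)^♯ = tau(c)·`. [folklore] -/
theorem IsRootTower.sharp_mulLeft (h : IsRootTower L K (p ^ e) x a) (c : K) (w : BoxQuot (Fin s) K (p ^ e)) :
    h.sharp (LinearMap.mulLeft L c) w = h.tau c * w := by
  have : LinearMap.mulLeft L c = c • (LinearMap.id : K →ₗ[L] K) := by
    ext y; rw [LinearMap.mulLeft_apply, LinearMap.smul_apply, LinearMap.id_apply, smul_eq_mul]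
  rw [this, h.sharp_smul, h.sharp_id, LinearMap.id_apply]

/-- **`(D^{(e_i)})^♯ = ∂/∂u_i`**: the Hasse–Schmidt derivations of the `p`-basis become the partial derivatives of the
truncated polynomial ring. [cite: EGAIV4, Thm. 16.11.2] -/
theorem IsRootTower.sharp_hsD_single (h : IsRootTower L K (p ^ e) x a) (he : 1 ≤ e) (i : Fin s) :
    h.sharp (h.hsD (Finsupp.single i 1)) = boxDeriv K s (p ^ e) i := by
  refine h.linearMap_ext_tau fun y z => ?_
  rw [h.sharp_tmul, boxDeriv_C_mul he, h.boxDeriv_tau he]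

/-! ### The kernel only grows -/

/-- `ker Φ^♯ = Ω̃ (ker (1 ⊗ Φ))`. [folklore] -/
theorem IsRootTower.ker_sharp_eq_map (h : IsRootTower L K (p ^ e) x a) (Φ : K →ₗ[L] K) :
    LinearMap.ker (h.sharp Φ) = (LinearMap.ker (Φ.baseChange K)).map h.omegaEquiv.toLinearMap := by
  ext w
  rw [LinearMap.mem_ker, Submodule.mem_map_equiv, LinearMap.mem_ker]
  unfold IsRootTower.sharp
  rw [LinearMap.comp_apply, LinearMap.comp_apply, LinearEquiv.coe_toLinearMap, LinearEquiv.coe_toLinearMap,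
    LinearEquiv.map_eq_zero_iff]

/-- **`dim_L ker Φ ≤ dim_K ker Φ^♯`**: `K ⊗_L ker Φ` embeds in `ker(1 ⊗ Φ)` (`K` is flat over `L`) and
`dim_K (K ⊗_L ker Φ) = dim_L ker Φ`. [cite: Mizutani1973HironakaGroupSchemes, Lemma 2.9 (proof: base change along Jacobson's identification)] -/
theorem IsRootTower.finrank_ker_le_finrank_ker_sharp (h : IsRootTower L K (p ^ e) x a) (Φ : K →ₗ[L] K) :
    Module.finrank L (LinearMap.ker Φ) ≤ Module.finrank K (LinearMap.ker (h.sharp Φ)) := by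
  haveI := h.finiteDimensional
  rw [h.ker_sharp_eq_map, LinearEquiv.finrank_map_eq]
  set ι : (LinearMap.ker Φ) →ₗ[L] K := (LinearMap.ker Φ).subtype with hι
  have hrange : LinearMap.range (ι.baseChange K) ≤ LinearMap.ker (Φ.baseChange K) := by
    rw [LinearMap.range_le_ker_iff, ← LinearMap.baseChange_comp, hι, LinearMap.comp_ker_subtype,
      LinearMap.baseChange_zero]
  have hinj : Function.Injective (ι.baseChange K) := by
    have := Module.Flat.lTensor_preserves_injective_linearMap (M := K) ι (Submodule.injective_subtype _)
    rwa [← LinearMap.baseChange_eq_ltensor] at this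
  calc Module.finrank L (LinearMap.ker Φ) = Module.finrank K (K ⊗[L] LinearMap.ker Φ) :=
        (Module.finrank_baseChange (R := K) (S := L) (M' := LinearMap.ker Φ)).symm
    _ = Module.finrank K (LinearMap.range (ι.baseChange K)) := (LinearMap.finrank_range_of_inj hinj).symm
    _ ≤ Module.finrank K (LinearMap.ker (Φ.baseChange K)) := Submodule.finrank_mono hrange

end Sharp

end Summit.ResolutionOfSingularities.KangarooAtlas.Mizutani
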